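import Mathlib
import Literature.Analysis.FluidPDE.VectorCalculus
import Summits.NavierStokesRegularity.NavierStokesRegularity.Theorems.UnthreadedDoorFluxStarvedDipoleLatitudeCirculation
import HarnessLib

/-!
# Route `UnthreadedDoor`, crux `PoloidalLiouville` (stmt-NavierStokesRegularity-1222), wall W1 — crux idea
# «flux-starved-dipoles» (ns-idea-15 g12/g13, `Cruxes/PoloidalLiouville/FluxStarvedDipoleSketch.lean`):
# SURFACE DIVERGENCE IN THE MOVING FRAME and ZERO FLUX OF TANGENT SOLENOIDAL FIELDS ACROSS LATITUDE CIRCLES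
# (second brick of L0 `SphereTangentUnthreadedVanishes`; twin of `…LatitudeCirculation`, p838833)

L0 says: `u ∈ C¹` divergence-free, tangent to the spheres of a shell about `x₀` and unthreaded there, vanishes on the shell.  In the
moving frame `(ξ̂, θ̂, φ̂)` of any axis the tangential field `(u_θ, u_φ)` then satisfies the Cauchy–Riemann-type system
`∂_θ(sin θ·u_φ) = ∂_φ u_θ` (unthreaded, p838833) and `∂_θ(sin θ·u_θ) = −∂_φ u_φ` (THIS FILE: tangent + solenoidal), whose
`φ`-averages are the two conservation laws "zero circulation" (p838833) and "zero flux" (here) around / across every latitude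
circle.  Contents:

* `hasDerivAt_meridional_meridian` — `d/dθ [sin θ·u_θ]` along a meridian (`dθ̂/dθ = −ξ̂`);
* `hasDerivAt_azimuthal_latitude` — `d/dφ u_φ` along a latitude circle (`dφ̂/dφ = −ρ̂`);
* `surfaceDivergence_movingFrame` — `r sin θ·div u = sin θ·r⟪ξ̂, Du ξ̂⟫ + ∂_θ(sin θ·u_θ) + ∂_φ u_φ + 2 sin θ·u_ξ` (pointwise);
* `latitudeFlux_eq_zero_of_tangent_divFree` — for `u ∈ C¹` divergence-free and tangent to the spheres `S_s(x₀)`, `r₁ < s < r₂`: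
  on every sphere of the shell, for every axis `n`, unit `e ⊥ n` and colatitude `θ`,
  `∫₀^{2π} sin θ·⟪u(x₀ + r cos θ·n + r sin θ·ρ̂(φ)), θ̂(φ)⟫ dφ = 0` — zero flux of the tangential field across every latitude
  circle (the in-sphere Gauss theorem on polar caps, done by `d/dθ` under the integral sign).

HONEST LABEL: kinematics of the tangent/unthreaded class (information-grade for W1, movement 0); L0, C2, K1′, `PoloidalLiouville`
(1222), its wall `stub_scalarLiouville` and the summit stay OPEN; NO Navier–Stokes regularity statement is proved.
`--supports stmt-NavierStokesRegularity-1222` (helper).  [folklore]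
-/

noncomputable section

-- the summit and its single sub-problem share the name (CONVENTIONS §1)
set_option linter.dupNamespace false

open Set Filter Topology InnerProductSpace MeasureTheory
open scoped RealInnerProductSpace
open Literature.Analysis.FluidPDE
open Summit.NavierStokesRegularity.NavierStokesRegularity.Theorems.PoloidalLiouville.HorizonTower (E3)
open Summit.NavierStokesRegularity.NavierStokesRegularity.Theorems.PoloidalLiouville.KinematicShadow (PointSource.cross_smul_right
  PointSource.cross_add_right PointSource.cross_self PointSource.cross_anticomm)

namespace Summit.NavierStokesRegularity.NavierStokesRegularity.Theorems.PoloidalLiouville.FluxStarvedDipole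

/-! ### Kinematic chain rules -/

/-- **Along a meridian**: `d/dθ [sin θ·⟪u(x₀ + r cos θ·n + r sin θ·ρ), θ̂(θ)⟫] = cos θ·u_θ + sin θ·(⟪u, −ξ̂⟫ + ⟪Du[r θ̂], θ̂⟫)`
(`θ̂ = −sin θ·n + cos θ·ρ`, `dθ̂/dθ = −ξ̂`, `ξ̂ = cos θ·n + sin θ·ρ`). [folklore] -/
theorem hasDerivAt_meridional_meridian {u : E3 → E3} (hu : ContDiff ℝ 1 u) (x₀ n ρ : E3) (r θ : ℝ) :
    HasDerivAt (fun θ : ℝ => Real.sin θ *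
        ⟪u (x₀ + (r * Real.cos θ) • n + (r * Real.sin θ) • ρ), (-Real.sin θ) • n + Real.cos θ • ρ⟫)
      (Real.cos θ * ⟪u (x₀ + (r * Real.cos θ) • n + (r * Real.sin θ) • ρ), (-Real.sin θ) • n + Real.cos θ • ρ⟫
        + Real.sin θ * (⟪u (x₀ + (r * Real.cos θ) • n + (r * Real.sin θ) • ρ), -(Real.cos θ • n + Real.sin θ • ρ)⟫
          + ⟪fderiv ℝ u (x₀ + (r * Real.cos θ) • n + (r * Real.sin θ) • ρ)
              (r • ((-Real.sin θ) • n + Real.cos θ • ρ)), (-Real.sin θ) • n + Real.cos θ • ρ⟫)) θ := by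
  have hβ : HasDerivAt (fun θ : ℝ => x₀ + (r * Real.cos θ) • n + (r * Real.sin θ) • ρ)
      (r • ((-Real.sin θ) • n + Real.cos θ • ρ)) θ := by
    have h1 : HasDerivAt (fun θ : ℝ => x₀ + (r * Real.cos θ) • n) ((r * -Real.sin θ) • n) θ :=
      (((Real.hasDerivAt_cos θ).const_mul r).smul_const n).const_add x₀
    have h2 : HasDerivAt (fun θ : ℝ => (r * Real.sin θ) • ρ) ((r * Real.cos θ) • ρ) θ :=
      ((Real.hasDerivAt_sin θ).const_mul r).smul_const ρ
    exact (h1.add h2).congr_deriv (by module)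
  have hU : HasDerivAt (fun θ : ℝ => u (x₀ + (r * Real.cos θ) • n + (r * Real.sin θ) • ρ))
      (fderiv ℝ u (x₀ + (r * Real.cos θ) • n + (r * Real.sin θ) • ρ) (r • ((-Real.sin θ) • n + Real.cos θ • ρ))) θ :=
    (hu.differentiable one_ne_zero _).hasFDerivAt.comp_hasDerivAt θ hβ
  have hI := hU.inner ℝ (hasDerivAt_thetaHat n ρ θ)
  exact (Real.hasDerivAt_sin θ).mul hI

/-- **Along a latitude circle**: `d/dφ ⟪u(γ(φ)), φ̂(φ)⟫ = ⟪u, −ρ̂(φ)⟫ + ⟪Du[r sin θ·φ̂], φ̂⟫` for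
`γ(φ) = x₀ + r cos θ·n + r sin θ·ρ̂(φ)`, `ρ̂(φ) = cos φ·e + sin φ·(n × e)`, `φ̂ = dρ̂/dφ`. [folklore] -/
theorem hasDerivAt_azimuthal_latitude {u : E3 → E3} (hu : ContDiff ℝ 1 u) (x₀ n e : E3) (r θ φ : ℝ) :
    HasDerivAt (fun φ : ℝ => ⟪u (x₀ + (r * Real.cos θ) • n + (r * Real.sin θ) • (Real.cos φ • e + Real.sin φ • cross n e)),
        (-Real.sin φ) • e + Real.cos φ • cross n e⟫)
      (⟪u (x₀ + (r * Real.cos θ) • n + (r * Real.sin θ) • (Real.cos φ • e + Real.sin φ • cross n e)),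
          -(Real.cos φ • e + Real.sin φ • cross n e)⟫
        + ⟪fderiv ℝ u (x₀ + (r * Real.cos θ) • n + (r * Real.sin θ) • (Real.cos φ • e + Real.sin φ • cross n e))
            ((r * Real.sin θ) • ((-Real.sin φ) • e + Real.cos φ • cross n e)),
          (-Real.sin φ) • e + Real.cos φ • cross n e⟫) φ := by
  have hγ := hasDerivAt_latitudeCircle n e x₀ r (Real.cos θ) (Real.sin θ) φ
  have hU : HasDerivAt
      (fun φ : ℝ => u (x₀ + (r * Real.cos θ) • n + (r * Real.sin θ) • (Real.cos φ • e + Real.sin φ • cross n e)))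
      (fderiv ℝ u (x₀ + (r * Real.cos θ) • n + (r * Real.sin θ) • (Real.cos φ • e + Real.sin φ • cross n e))
        ((r * Real.sin θ) • ((-Real.sin φ) • e + Real.cos φ • cross n e))) φ :=
    (hu.differentiable one_ne_zero _).hasFDerivAt.comp_hasDerivAt φ hγ
  exact hU.inner ℝ (hasDerivAt_thetaHat e (cross n e) φ)

/-! ### The surface divergence in the moving frame -/

/-- **SURFACE DIVERGENCE IN THE MOVING FRAME.**  At `x = x₀ + r cos θ·n + r sin θ·ρ` (orthonormal pair `(n, ρ)`, `p = n × ρ`,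
`ξ̂ = cos θ·n + sin θ·ρ`, `θ̂ = −sin θ·n + cos θ·ρ`):
`r sin θ·div u(x) = sin θ·r⟪ξ̂, Du ξ̂⟫ + [cos θ·u_θ + sin θ·(⟪u,−ξ̂⟫ + ⟪Du[rθ̂], θ̂⟫)] + [⟪u, −ρ⟫ + ⟪Du[r sin θ·p], p⟫] + 2 sin θ·u_ξ`
— the two brackets are `∂_θ(sin θ·u_θ)` and `∂_φ u_φ` of the previous lemmas (`div u` is the trace of `Du` in the frame). [folklore] -/
theorem surfaceDivergence_movingFrame (u : E3 → E3) (x : E3) {n ρ : E3} (hn : ‖n‖ = 1) (hρ : ‖ρ‖ = 1)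
    (hnρ : ⟪n, ρ⟫ = 0) (r θ : ℝ) :
    r * Real.sin θ * VectorCalculus.divergence u x =
      Real.sin θ * (r * ⟪Real.cos θ • n + Real.sin θ • ρ, fderiv ℝ u x (Real.cos θ • n + Real.sin θ • ρ)⟫)
      + (Real.cos θ * ⟪u x, (-Real.sin θ) • n + Real.cos θ • ρ⟫
          + Real.sin θ * (⟪u x, -(Real.cos θ • n + Real.sin θ • ρ)⟫
            + ⟪fderiv ℝ u x (r • ((-Real.sin θ) • n + Real.cos θ • ρ)), (-Real.sin θ) • n + Real.cos θ • ρ⟫))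
      + (⟪u x, -ρ⟫ + ⟪fderiv ℝ u x ((r * Real.sin θ) • cross n ρ), cross n ρ⟫)
      + 2 * Real.sin θ * ⟪u x, Real.cos θ • n + Real.sin θ • ρ⟫ := by
  obtain ⟨hξ1, hτ1, hξτ, hp⟩ := movingFrame_facts hn hρ hnρ (Real.cos_sq_add_sin_sq θ)
  rw [divergence_pairFrame u x hξ1 hτ1 hξτ, hp]
  have hρdec : ρ = Real.sin θ • (Real.cos θ • n + Real.sin θ • ρ) + Real.cos θ • ((-Real.sin θ) • n + Real.cos θ • ρ) := by
    have h1 : Real.sin θ • (Real.cos θ • n + Real.sin θ • ρ) + Real.cos θ • ((-Real.sin θ) • n + Real.cos θ • ρ)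
        = (Real.cos θ ^ 2 + Real.sin θ ^ 2) • ρ := by module
    rw [h1, Real.cos_sq_add_sin_sq, one_smul]
  have hUρ : ⟪u x, -ρ⟫ = -(Real.sin θ * ⟪u x, Real.cos θ • n + Real.sin θ • ρ⟫
      + Real.cos θ * ⟪u x, (-Real.sin θ) • n + Real.cos θ • ρ⟫) := by
    rw [inner_neg_right]
    conv_lhs => rw [hρdec]
    rw [inner_add_right, inner_smul_right, inner_smul_right]
  rw [hUρ, map_smul, map_smul, real_inner_smul_left, real_inner_smul_left, inner_neg_right,
    real_inner_comm ((-Real.sin θ) • n + Real.cos θ • ρ) (fderiv ℝ u x ((-Real.sin θ) • n + Real.cos θ • ρ)),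
    real_inner_comm (cross n ρ) (fderiv ℝ u x (cross n ρ))]
  ring

/-! ### Zero flux of tangent solenoidal fields across latitude circles -/

/-- **TANGENT + SOLENOIDAL ⇒ ZERO FLUX ACROSS EVERY LATITUDE CIRCLE.**  Let `u ∈ C¹(ℝ³; ℝ³)` be divergence-free and tangent to
the spheres `S_s(x₀)` for `r₁ < s < r₂` (`⟪u(x), x − x₀⟫ = 0` on the open shell).  Then on every sphere `S_r(x₀)` of the shell,
for every unit axis `n`, unit `e ⊥ n` and colatitude `θ`:
`∫₀^{2π} sin θ·⟪u(x₀ + r cos θ·n + r sin θ·ρ̂(φ)), −sin θ·n + cos θ·ρ̂(φ)⟫ dφ = 0`, `ρ̂(φ) = cos φ·e + sin φ·(n × e)`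
(the flux `r·(this)` of the tangential field out of the polar cap vanishes).  Proof: tangency on the open shell kills `u_ξ` and
the radial strain `⟪ξ̂, Du ξ̂⟫`, so `surfaceDivergence_movingFrame` reads `∂_θ(sin θ·u_θ) = −∂_φ u_φ`; differentiate under the
integral sign and use periodicity; the flux vanishes at `θ = 0`. [folklore] -/
theorem latitudeFlux_eq_zero_of_tangent_divFree {u : E3 → E3} (hu : ContDiff ℝ 1 u)
    (hdiv : Literature.Analysis.FluidPDE.VectorCalculus.IsDivFree u) (x₀ : E3) {r₁ r₂ r : ℝ} (hr₁ : 0 ≤ r₁)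
    (h₁ : r₁ < r) (h₂ : r < r₂)
    (htan : ∀ x : E3, r₁ < ‖x - x₀‖ → ‖x - x₀‖ < r₂ → ⟪u x, x - x₀⟫ = 0) {n e : E3} (hn : ‖n‖ = 1) (he : ‖e‖ = 1)
    (hne : ⟪n, e⟫ = 0) (θ : ℝ) :
    ∫ φ in (0 : ℝ)..2 * Real.pi, Real.sin θ *
        ⟪u (x₀ + (r * Real.cos θ) • n + (r * Real.sin θ) • (Real.cos φ • e + Real.sin φ • cross n e)),
          (-Real.sin θ) • n + Real.cos θ • (Real.cos φ • e + Real.sin φ • cross n e)⟫ = 0 := by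
  have hr : 0 < r := lt_of_le_of_lt hr₁ h₁
  -- the frame `(n, e, n × e)` and the rotating pair `(n, ρ̂(φ))`
  obtain ⟨hf1, hfn, hfe, hnf, -⟩ := pairFrame_facts hn he hne
  have hnf' : ⟪n, cross n e⟫ = 0 := by rw [real_inner_comm]; exact hfn
  have hef' : ⟪e, cross n e⟫ = 0 := by rw [real_inner_comm]; exact hfe
  have hρ1 : ∀ φ, ‖Real.cos φ • e + Real.sin φ • cross n e‖ = 1 := fun φ =>
    (movingFrame_facts he hf1 hef' (Real.cos_sq_add_sin_sq φ)).1
  have hnρ : ∀ φ, ⟪n, Real.cos φ • e + Real.sin φ • cross n e⟫ = 0 := fun φ => by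
    rw [inner_add_right, inner_smul_right, inner_smul_right, hne, hnf', mul_zero, mul_zero, add_zero]
  have hnρx : ∀ φ, cross n (Real.cos φ • e + Real.sin φ • cross n e) = (-Real.sin φ) • e + Real.cos φ • cross n e := by
    intro φ
    rw [PointSource.cross_add_right, PointSource.cross_smul_right, PointSource.cross_smul_right, hnf]
    module
  -- tangency on the open shell: `u_ξ = 0` and `⟪ξ̂, Du ξ̂⟫ = 0` on `S_r(x₀)`
  have hshell : ∀ y : E3, ‖y‖ = r → ⟪u (x₀ + y), y⟫ = 0 ∧ ⟪y, fderiv ℝ u (x₀ + y) y⟫ = 0 := by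
    intro y hy
    have hO : IsOpen {z : E3 | r₁ < ‖z - x₀‖ ∧ ‖z - x₀‖ < r₂} := by
      have hc : Continuous fun z : E3 => ‖z - x₀‖ := continuous_norm.comp (continuous_id.sub continuous_const)
      exact (isOpen_lt continuous_const hc).inter (isOpen_lt hc continuous_const)
    have hmem : x₀ + y ∈ {z : E3 | r₁ < ‖z - x₀‖ ∧ ‖z - x₀‖ < r₂} := by
      simp only [mem_setOf_eq, add_sub_cancel_left, hy]; exact ⟨h₁, h₂⟩
    have hev : (fun z => ⟪u z, z - x₀⟫) =ᶠ[𝓝 (x₀ + y)] fun _ => (0 : ℝ) := by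
      filter_upwards [hO.mem_nhds hmem] with z hz
      exact htan z hz.1 hz.2
    have h0 : ⟪u (x₀ + y), y⟫ = 0 := by have := htan (x₀ + y) hmem.1 hmem.2; rwa [add_sub_cancel_left] at this
    refine ⟨h0, ?_⟩
    have hd : fderiv ℝ (fun z => ⟪u z, z - x₀⟫) (x₀ + y) = 0 := by rw [hev.fderiv_eq, fderiv_const_apply]
    have h1 : HasFDerivAt u (fderiv ℝ u (x₀ + y)) (x₀ + y) := (hu.differentiable one_ne_zero _).hasFDerivAt
    have h2 : HasFDerivAt (fun z : E3 => z - x₀) (ContinuousLinearMap.id ℝ E3) (x₀ + y) := (hasFDerivAt_id _).sub_const x₀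
    have h := congrArg (fun L : E3 →L[ℝ] ℝ => L y) ((h1.inner ℝ h2).fderiv.symm.trans hd)
    simp only [ContinuousLinearMap.coe_comp, Function.comp_apply, ContinuousLinearMap.prod_apply,
      fderivInnerCLM_apply, ContinuousLinearMap.coe_id', id_eq, add_sub_cancel_left, zero_apply] at h
    rw [h0, zero_add, real_inner_comm] at h
    exact h
  -- the integrand `F θ φ = sin θ·u_θ` and its `θ`-derivative
  set F : ℝ → ℝ → ℝ := fun θ φ => Real.sin θ *
    ⟪u (x₀ + (r * Real.cos θ) • n + (r * Real.sin θ) • (Real.cos φ • e + Real.sin φ • cross n e)),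
      (-Real.sin θ) • n + Real.cos θ • (Real.cos φ • e + Real.sin φ • cross n e)⟫ with hF
  set F' : ℝ → ℝ → ℝ := fun θ φ =>
    Real.cos θ * ⟪u (x₀ + (r * Real.cos θ) • n + (r * Real.sin θ) • (Real.cos φ • e + Real.sin φ • cross n e)),
        (-Real.sin θ) • n + Real.cos θ • (Real.cos φ • e + Real.sin φ • cross n e)⟫
      + Real.sin θ * (⟪u (x₀ + (r * Real.cos θ) • n + (r * Real.sin θ) • (Real.cos φ • e + Real.sin φ • cross n e)),
            -(Real.cos θ • n + Real.sin θ • (Real.cos φ • e + Real.sin φ • cross n e))⟫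
          + ⟪fderiv ℝ u (x₀ + (r * Real.cos θ) • n + (r * Real.sin θ) • (Real.cos φ • e + Real.sin φ • cross n e))
              (r • ((-Real.sin θ) • n + Real.cos θ • (Real.cos φ • e + Real.sin φ • cross n e))),
            (-Real.sin θ) • n + Real.cos θ • (Real.cos φ • e + Real.sin φ • cross n e)⟫) with hF'
  have hFd : ∀ θ φ, HasDerivAt (fun θ => F θ φ) (F' θ φ) θ := fun θ φ =>
    hasDerivAt_meridional_meridian hu x₀ n (Real.cos φ • e + Real.sin φ • cross n e) r θ
  -- incompressibility + tangency: `F' θ φ = −∂_φ u_φ`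
  have hF'eq : ∀ θ φ, HasDerivAt (fun φ : ℝ =>
      ⟪u (x₀ + (r * Real.cos θ) • n + (r * Real.sin θ) • (Real.cos φ • e + Real.sin φ • cross n e)),
        (-Real.sin φ) • e + Real.cos φ • cross n e⟫) (-F' θ φ) φ := by
    intro θ φ
    refine (hasDerivAt_azimuthal_latitude hu x₀ n e r θ φ).congr_deriv ?_
    have hD := surfaceDivergence_movingFrame u
      (x₀ + (r * Real.cos θ) • n + (r * Real.sin θ) • (Real.cos φ • e + Real.sin φ • cross n e)) hn (hρ1 φ) (hnρ φ) r θ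
    rw [hnρx φ, hdiv, mul_zero] at hD
    have hξ1 := (movingFrame_facts hn (hρ1 φ) (hnρ φ) (Real.cos_sq_add_sin_sq θ)).1
    have hy : (r * Real.cos θ) • n + (r * Real.sin θ) • (Real.cos φ • e + Real.sin φ • cross n e)
        = r • (Real.cos θ • n + Real.sin θ • (Real.cos φ • e + Real.sin φ • cross n e)) := by module
    have hnorm : ‖(r * Real.cos θ) • n + (r * Real.sin θ) • (Real.cos φ • e + Real.sin φ • cross n e)‖ = r := by
      rw [hy, norm_smul, hξ1, mul_one, Real.norm_of_nonneg hr.le]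
    obtain ⟨hUr, hSr⟩ := hshell _ hnorm
    rw [← add_assoc] at hUr hSr
    rw [hy, inner_smul_right] at hUr
    rw [hy, map_smul, inner_smul_right, real_inner_smul_left] at hSr
    have hUξ : ⟪u (x₀ + (r * Real.cos θ) • n + (r * Real.sin θ) • (Real.cos φ • e + Real.sin φ • cross n e)),
        Real.cos θ • n + Real.sin θ • (Real.cos φ • e + Real.sin φ • cross n e)⟫ = 0 := by
      rcases mul_eq_zero.mp hUr with h | h
      · exact absurd h hr.ne'
      · exact h
    have hSξ : r * ⟪Real.cos θ • n + Real.sin θ • (Real.cos φ • e + Real.sin φ • cross n e),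
        fderiv ℝ u (x₀ + (r * Real.cos θ) • n + (r * Real.sin θ) • (Real.cos φ • e + Real.sin φ • cross n e))
          (Real.cos θ • n + Real.sin θ • (Real.cos φ • e + Real.sin φ • cross n e))⟫ = 0 := by
      have h : r * (r * ⟪Real.cos θ • n + Real.sin θ • (Real.cos φ • e + Real.sin φ • cross n e),
          fderiv ℝ u (x₀ + (r * Real.cos θ) • n + (r * Real.sin θ) • (Real.cos φ • e + Real.sin φ • cross n e))
            (Real.cos θ • n + Real.sin θ • (Real.cos φ • e + Real.sin φ • cross n e))⟫) = 0 := hSr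
      rcases mul_eq_zero.mp h with h' | h'
      · exact absurd h' hr.ne'
      · exact h'
    rw [hUξ, hSξ] at hD
    simp only [hF']
    linarith
  -- continuity of `F`, `F'`
  have hfd : Continuous (fderiv ℝ u) := hu.continuous_fderiv one_ne_zero
  have huc : Continuous u := hu.continuous
  have hcontF : Continuous (Function.uncurry F) := by
    simp only [hF, Function.uncurry_def]
    fun_prop
  have hcontF' : Continuous (Function.uncurry F') := by
    simp only [hF', Function.uncurry_def]
    fun_prop
  have hsec : ∀ θ₀ : ℝ, Continuous fun φ : ℝ => (θ₀, φ) := fun θ₀ => continuous_const.prodMk continuous_id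
  -- `d/dθ` of the flux vanishes
  have hΓ : ∀ θ₀ : ℝ, HasDerivAt (fun θ => ∫ φ in (0 : ℝ)..2 * Real.pi, F θ φ) 0 θ₀ := by
    intro θ₀
    have hK : IsCompact (Icc (θ₀ - 1) (θ₀ + 1) ×ˢ Icc (-(2 * Real.pi)) (2 * Real.pi)) :=
      isCompact_Icc.prod isCompact_Icc
    obtain ⟨M, hM⟩ := hK.exists_bound_of_continuousOn hcontF'.continuousOn
    have hint : ∫ φ in (0 : ℝ)..2 * Real.pi, F' θ₀ φ = 0 := by
      have h := intervalIntegral.integral_eq_sub_of_hasDerivAt (fun φ _ => hF'eq θ₀ φ)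
        (((hcontF'.comp (hsec θ₀)).neg).intervalIntegrable 0 (2 * Real.pi))
      simp only [Real.cos_two_pi, Real.sin_two_pi, Real.cos_zero, Real.sin_zero, sub_self,
        intervalIntegral.integral_neg, neg_eq_zero] at h
      exact h
    have hpi : 0 ≤ 2 * Real.pi := by positivity
    have h := intervalIntegral.hasDerivAt_integral_of_dominated_loc_of_deriv_le (μ := volume)
      (F := F) (F' := F') (x₀ := θ₀) (a := 0) (b := 2 * Real.pi) (bound := fun _ => M) (s := Icc (θ₀ - 1) (θ₀ + 1))
      (Icc_mem_nhds (by linarith) (by linarith))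
      (Eventually.of_forall fun θ => (hcontF.comp (hsec θ)).aestronglyMeasurable)
      ((hcontF.comp (hsec θ₀)).intervalIntegrable 0 (2 * Real.pi))
      ((hcontF'.comp (hsec θ₀)).aestronglyMeasurable)
      (Eventually.of_forall fun φ hφ θ hθ => by
        rw [Set.uIoc_of_le hpi] at hφ
        exact hM (θ, φ) ⟨hθ, ⟨by linarith [hφ.1], hφ.2⟩⟩)
      intervalIntegrable_const
      (Eventually.of_forall fun φ _ θ _ => hFd θ φ)
    rw [hint] at h
    exact h.2
  have hdiff : Differentiable ℝ fun θ => ∫ φ in (0 : ℝ)..2 * Real.pi, F θ φ := fun θ => (hΓ θ).differentiableAt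
  have hconst := is_const_of_deriv_eq_zero hdiff (fun θ => (hΓ θ).deriv) θ 0
  rw [hconst]
  simp only [hF, Real.sin_zero, zero_mul, intervalIntegral.integral_zero]

end Summit.NavierStokesRegularity.NavierStokesRegularity.Theorems.PoloidalLiouville.FluxStarvedDipole

end
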